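import Mathlib
import Summits.Ventures.PercRepro2.A3InactiveTyped

/-!
# Typed BHK 1.1 with two avoidance sets — the inductive target of the S4 proof programme, as a Prop
(blind cell PercRepro2, p5 g0, 2026-08-25; ASSIGNMENTS v12.58 (2) «p5: its typed statement in the
state-kernel vocabulary»; mine-c MINE-C.md §20–§21 (T11), engine D234, p5 kit j231737)

In the two-copy vocabulary of `A3InactiveTyped` (`pairCount F z Φ` = the sum over the first copies
`y` agreeing with the pinning `z` off the free set `F` of `Φ y (flipOn F y)`, the second copy being
the complement on `F`): for a root `s`, vertices `a, b` and avoidance sets `X, Y`,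

  (T11)  `N(A ∩ R_X, B ∩ R_Y) ≤ N(A ∩ B ∩ R_{X ∩ Y}, R_{X ∪ Y})`,   `A = {s ↔ a}`, `B = {s ↔ b}`,
         `R_X = {C(s) ∩ X = ∅}` (`avoidAll ends s X`),

the profile-wise (Bernstein-coefficient) form of van den Berg–Kahn's Theorem 1.2 / BHK's Theorem 1.1
for single-vertex events. CANDIDATE (census: mine-c typed11 + engine D234 + p5, two/three codes at
`n = 5`; `n = 6`, `m ≤ 10` all profiles clean for every `X ≠ Y`, disjoint pairs included); NOT a
theorem. `X = Y` is typed BHK 1.3 for single-vertex events; `TB13_of_TB11` records that.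
Nothing here is proved beyond the specialisation.
-/

namespace Summit.Ventures.PercRepro2

namespace A3InactiveTyped

open CovForm

section Props

variable {V : Type*} {E : Type*} {R : Type*} [Field R]

/-- `1_{s ↔ a}(y) · 1_{C(s) ∩ X = ∅}(y) · 1_{s ↔ b}(w) · 1_{C(s) ∩ Y = ∅}(w)` — the left side of (T11):
`A ∩ R_X` on the first copy, `B ∩ R_Y` on the second. -/
noncomputable def lhs11 (ends : E → Sym2 V) (s a b : V) (X Y : Finset V) :
    Config E → Config E → R :=
  fun y w => iL ends s a y * (avoidAll ends s X).indicator 1 y *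
    (iL ends s b w * (avoidAll ends s Y).indicator 1 w)

/-- `1_{s ↔ a}(y) · 1_{s ↔ b}(y) · 1_{C(s) ∩ (X ∩ Y) = ∅}(y) · 1_{C(s) ∩ (X ∪ Y) = ∅}(w)` — the right side
of (T11): `A ∩ B ∩ R_{X ∩ Y}` on the first copy, `R_{X ∪ Y}` on the second. -/
noncomputable def rhs11 [DecidableEq V] (ends : E → Sym2 V) (s a b : V) (X Y : Finset V) :
    Config E → Config E → R :=
  fun y w => iL ends s a y * iL ends s b y * (avoidAll ends s (X ∩ Y)).indicator 1 y *
    (avoidAll ends s (X ∪ Y)).indicator 1 w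

end Props

/-- **Typed BHK 1.1 for single-vertex events with two avoidance sets** (the Prop `TB11`; CANDIDATE,
NOT a theorem): for every finite graph, every profile (free set `F`, pinned `z`), every root `s`,
vertices `a, b` and sets `X, Y`: `N(A ∩ R_X, B ∩ R_Y) ≤ N(A ∩ B ∩ R_{X∩Y}, R_{X∪Y})`. The inductive
target of the S4 proof programme (ASSIGNMENTS v12.58 (2)). -/
def TB11 (R : Type*) [Field R] [LinearOrder R] : Prop :=
  ∀ (V E : Type) [Fintype V] [DecidableEq V] [Fintype E] [DecidableEq E] (ends : E → Sym2 V)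
    (s a b : V) (X Y : Finset V) (F : Finset E) (z : Config E),
    pairCount F z (lhs11 ends s a b X Y : Config E → Config E → R) ≤
      pairCount F z (rhs11 ends s a b X Y)

/-- **Typed BHK 1.3 for single-vertex events** (the Prop `TB13sv`; CANDIDATE): the case `X = Y` of
(T11): `N(A ∩ R_X, B ∩ R_X) ≤ N(A ∩ B ∩ R_X, R_X)`. -/
def TB13sv (R : Type*) [Field R] [LinearOrder R] : Prop :=
  ∀ (V E : Type) [Fintype V] [DecidableEq V] [Fintype E] [DecidableEq E] (ends : E → Sym2 V)
    (s a b : V) (X : Finset V) (F : Finset E) (z : Config E),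
    pairCount F z (lhs11 ends s a b X X : Config E → Config E → R) ≤
      pairCount F z (rhs11 ends s a b X X)

/-- (T11) specialises to typed BHK 1.3 for single-vertex events. -/
theorem TB13sv_of_TB11 (R : Type*) [Field R] [LinearOrder R] (h : TB11 R) : TB13sv R :=
  fun V E _ _ _ _ ends s a b X F z => h V E ends s a b X X F z

end A3InactiveTyped

end Summit.Ventures.PercRepro2
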